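import Summits.Parity.GeneralizedHardyLittlewood.Theorems.PolymathEpsThreeCeilingGridBoundHighRankActivityFiveConst
import Summits.Parity.GeneralizedHardyLittlewood.Theorems.PolymathEpsThreeCeilingGridBoundHighRankActivityIntegrals

/-!
# Route `PolymathEpsThreeCeiling`, crux `GridBoundHigh` (stmt-Parity-19069): the fibre budget of the five-constant
# rank/activity certificates in CLOSED FORM (generic outer pair `0 < s₁ ≤ s₀`)

For the five-constant parameter functions (`…RankActivityFiveConst.lean`) the fibre profile `fibreWeight` over an outer
pair `0 < s₁ ≤ s₀`, `s₀ + s₁ ≤ 1 - ε` (`ε ≥ 1/5`) is affine on the three rank pieces of the three-active zone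
`(0, η - s₀]` (`η = 1 - ε`), equal to `Λ - c` resp. `c` on the two pieces of the two-active zone `(η - s₀, min(η - s₁, L)]`
(split at `u = s₀`) and equal to `Λ` on `(η - s₁, L]`, `L = 1 + ε - s₀ - s₁` (item evidence `CENSUS-19069-orderone.md` §F7).
`RankActivity.lintegral_fibreWeight_five_le` bounds the fibre budget by the corresponding explicit six-term real
expression `RankActivity.fiveBudget` (three logarithms and three linear terms, breakpoints clipped with `min`/`max` so
that ONE formula serves every ordering).  What then remains of hypothesis `H` of `cwCert_of_fiveConst` for `s₁ > 0` is the
real inequality `fiveBudget … s₀ s₁ ≤ 1` (plus the elementary `s₁ = 0` fibres and the symmetry `fibreWeight_comm`).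
Support lemmas for stmt-Parity-19069 only; no summit claim.  Standard axioms.
-/

noncomputable section

open Finset MeasureTheory Set Filter

namespace Summit.Parity.GeneralizedHardyLittlewood.Theses.PolymathEpsThreeCeiling

namespace RankActivity

/-- Intercept of the smallest-rank affine piece (as a function of `ρ = s₀ + s₁`). -/
def fiveIS (ε Λ β d₁₀ d₀ ρ : ℝ) : ℝ := (Λ - 2 * d₁₀ - d₀ + ρ * (2 * d₁₀ / fiveS ε - β)) / 3
/-- Slope of the smallest-rank affine piece. -/
def fiveSS (ε β d₁₀ : ℝ) : ℝ := (2 * β + 2 * d₁₀ / fiveS ε) / 3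
/-- Intercept of the middle-rank affine piece. -/
def fiveIM (ε Λ β d₁₀ d₀ ρ : ℝ) : ℝ := fiveIS ε Λ β d₁₀ d₀ ρ + d₁₀ * (1 - ρ / fiveS ε)
/-- Slope of the middle- and largest-rank affine pieces. -/
def fiveSM (ε β d₁₀ : ℝ) : ℝ := (2 * β - d₁₀ / fiveS ε) / 3
/-- Intercept of the largest-rank affine piece. -/
def fiveIL (ε Λ β d₁₀ d₀ ρ : ℝ) : ℝ := fiveIM ε Λ β d₁₀ d₀ ρ + d₀

/-- The explicit six-term fibre budget of the five-constant certificate over the outer pair `s₁ ≤ s₀` (breakpoints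
`b₁ ≤ b₂ ≤ b₃ ≤ b₄ ≤ b₅ ≤ L` clipped with `min`/`max`; empty pieces contribute `0`). -/
def fiveBudget (ε Λ β d₁₀ d₀ c s₀ s₁ : ℝ) : ℝ :=
  let ρ := s₀ + s₁
  let L := 1 + ε - ρ
  let z := 1 - ε - s₀
  let e := min (1 - ε - s₁) L
  let b₁ := min s₁ z
  let b₂ := min s₀ z
  let b₄ := max z (min s₀ e)
  Real.log ((fiveIS ε Λ β d₁₀ d₀ ρ + fiveSS ε β d₁₀ * b₁) / (fiveIS ε Λ β d₁₀ d₀ ρ + fiveSS ε β d₁₀ * 0)) /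
        fiveSS ε β d₁₀
    + Real.log ((fiveIM ε Λ β d₁₀ d₀ ρ + fiveSM ε β d₁₀ * b₂) / (fiveIM ε Λ β d₁₀ d₀ ρ + fiveSM ε β d₁₀ * b₁)) /
        fiveSM ε β d₁₀
    + Real.log ((fiveIL ε Λ β d₁₀ d₀ ρ + fiveSM ε β d₁₀ * z) / (fiveIL ε Λ β d₁₀ d₀ ρ + fiveSM ε β d₁₀ * b₂)) /
        fiveSM ε β d₁₀
    + (b₄ - z) / (Λ - c) + (e - b₄) / c + (L - e) / Λ

/-- **The fibre budget of the five-constant certificate, generic case `0 < s₁ ≤ s₀`.** -/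
theorem lintegral_fibreWeight_five_le {ε Λ β d₁₀ d₀ c : ℝ} (hε : 1 / 5 ≤ ε) (hΛ : 0 < Λ)
    (hc1 : Λ / 2 ≤ c) (hc2 : c < Λ) (hd1 : 0 ≤ d₁₀) (hd0 : 0 ≤ d₀) (hβ : 0 < β)
    (hBM : 0 < 2 * β - d₁₀ / fiveS ε) (h1 : 2 * d₁₀ + d₀ < Λ)
    (h2 : β * (3 * (1 - ε) / 2) + 2 * (d₁₀ * (1 - (3 * (1 - ε) / 2) / fiveS ε)) + d₀ < Λ)
    {s₀ s₁ : ℝ} (hs1 : 0 < s₁) (hs01 : s₁ ≤ s₀) (hρ : s₀ + s₁ ≤ 1 - ε) :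
    ∫⁻ u in Ioc (0:ℝ) (1 + ε - (s₀ + s₁)),
        ENNReal.ofReal (fibreWeight ε Λ (fiveC c) (fiveAS ε Λ β d₁₀ d₀) (fiveD1 ε d₁₀) (fiveD0 ε d₀)
          (fiveB ε Λ β) s₀ s₁ u)⁻¹
      ≤ ENNReal.ofReal (fiveBudget ε Λ β d₁₀ d₀ c s₀ s₁) := by
  -- abbreviations (breakpoints only; the five constants stay explicit)
  set L := 1 + ε - (s₀ + s₁) with hLdef
  set z := 1 - ε - s₀ with hzdef
  set e := min (1 - ε - s₁) L with hedef
  set b₁ := min s₁ z with hb₁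
  set b₂ := min s₀ z with hb₂
  set b₄ := max z (min s₀ e) with hb₄
  set W : ℝ → ℝ := fun u => fibreWeight ε Λ (fiveC c) (fiveAS ε Λ β d₁₀ d₀) (fiveD1 ε d₁₀) (fiveD0 ε d₀)
    (fiveB ε Λ β) s₀ s₁ u with hWdef
  show ∫⁻ u in Ioc (0:ℝ) L, ENNReal.ofReal (W u)⁻¹ ≤ _
  have hs0 : 0 < s₀ := hs1.trans_le hs01
  have hη3 : 3 * (1 - ε) / 2 ≤ fiveS ε := by unfold fiveS; refine le_min ?_ ?_ <;> linarith
  have hSpos : 0 < fiveS ε := lt_of_lt_of_le (by linarith) hη3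
  -- the monotone chain of breakpoints `0 ≤ b₁ ≤ b₂ ≤ z ≤ b₄ ≤ e ≤ L`
  have hz0 : 0 ≤ z := by rw [hzdef]; linarith
  have hzL : z ≤ L := by rw [hzdef, hLdef]; linarith
  have hze : z ≤ e := le_min (by rw [hzdef]; linarith) hzL
  have heL : e ≤ L := min_le_right _ _
  have he1 : e ≤ 1 - ε - s₁ := min_le_left _ _
  have h01 : 0 ≤ b₁ := le_min hs1.le hz0
  have h12 : b₁ ≤ b₂ := min_le_min hs01 le_rfl
  have h2z : b₂ ≤ z := min_le_right _ _
  have hz4 : z ≤ b₄ := le_max_left _ _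
  have h4e : b₄ ≤ e := max_le hze (min_le_right _ _)
  -- slopes: positivity
  have hSSpos : 0 < fiveSS ε β d₁₀ := by
    unfold fiveSS; have := div_nonneg hd1 hSpos.le; positivity
  have hSMpos : 0 < fiveSM ε β d₁₀ := by unfold fiveSM; linarith
  -- value of the profile on the three-active pieces
  have hA3 : ∀ u, 0 < u → u ≤ z →
      W u = fiveIS ε Λ β d₁₀ d₀ (s₀ + s₁) + fiveSS ε β d₁₀ * u
              + (if s₁ < u then d₁₀ * (1 - (s₀ + s₁) / fiveS ε) - d₁₀ / fiveS ε * u else 0)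
              + (if s₀ < u then d₀ else 0) := by
    intro u hu0 huz
    have hσ : u + s₀ + s₁ ≤ 3 * (1 - ε) / 2 := by rw [hzdef] at huz; linarith
    have hσ0 : 0 ≤ u + s₀ + s₁ := by linarith
    have ha0 : 0 < s₀ ∧ u + s₁ ≤ 1 - ε := ⟨hs0, by rw [hzdef] at huz; linarith⟩
    have ha1 : 0 < s₁ ∧ u + s₀ ≤ 1 - ε := ⟨hs1, by rw [hzdef] at huz; linarith⟩
    have hor : (s₀ < u ∨ s₁ < u) ↔ s₁ < u :=
      ⟨fun h => h.elim (fun h' => lt_of_le_of_lt hs01 h') id, fun h => Or.inr h⟩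
    have hand : (s₀ < u ∧ s₁ < u) ↔ s₀ < u :=
      ⟨fun h => h.1, fun h => ⟨h, lt_of_le_of_lt hs01 h⟩⟩
    simp only [hWdef, fibreWeight, if_pos (And.intro ha0 ha1), fiveAS, fiveB, fiveD1, fiveD0, if_pos hσ,
      max_eq_right hσ0, if_congr hor rfl rfl, if_congr hand rfl rfl, fiveIS, fiveSS]
    split_ifs <;> ring
  -- value of the profile on the two-active pieces
  have hA2 : ∀ u, z < u → u ≤ e → W u = if s₀ < u then c else Λ - c := by
    intro u huz hue
    have ha0 : 0 < s₀ ∧ u + s₁ ≤ 1 - ε := ⟨hs0, by linarith [he1]⟩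
    have hna1 : ¬ (0 < s₁ ∧ u + s₀ ≤ 1 - ε) := fun h => by rw [hzdef] at huz; linarith [h.2]
    have hn3 : ¬ ((0 < s₀ ∧ u + s₁ ≤ 1 - ε) ∧ (0 < s₁ ∧ u + s₀ ≤ 1 - ε)) := fun h => hna1 h.2
    simp only [hWdef, fibreWeight, if_neg hn3, if_pos ha0, fiveC]
    split_ifs <;> ring
  -- value of the profile on the single-active piece
  have hA1 : ∀ u, e < u → u ≤ L → W u = Λ := by
    intro u hue huL
    have hue' : 1 - ε - s₁ < u := by
      rcases min_lt_iff.1 hue with h | h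
      · exact h
      · exact absurd huL (not_le.2 h)
    have hna0 : ¬ (0 < s₀ ∧ u + s₁ ≤ 1 - ε) := fun h => by linarith [h.2]
    have hna1 : ¬ (0 < s₁ ∧ u + s₀ ≤ 1 - ε) := fun h => by linarith [h.2]
    have hn3 : ¬ ((0 < s₀ ∧ u + s₁ ≤ 1 - ε) ∧ (0 < s₁ ∧ u + s₀ ≤ 1 - ε)) := fun h => hna0 h.1
    simp only [hWdef, fibreWeight, if_neg hn3, if_neg hna0, if_neg hna1]
  -- intercepts: positivity (`fiveIS … (s₀+s₁) = αS(ρ) > 0` by the two STRICT side conditions)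
  have hISpos : 0 < fiveIS ε Λ β d₁₀ d₀ (s₀ + s₁) := by
    have hM0 : 0 < 3 * (1 - ε) / 2 := by linarith
    set x := (s₀ + s₁) / (3 * (1 - ε) / 2) with hx
    have hx0 : 0 ≤ x := div_nonneg (by linarith) hM0.le
    have hx1 : x ≤ 1 := (div_le_one hM0).2 (by linarith)
    have hρx : s₀ + s₁ = x * (3 * (1 - ε) / 2) := by rw [hx]; exact (div_mul_cancel₀ _ hM0.ne').symm
    have e1 : fiveIS ε Λ β d₁₀ d₀ (s₀ + s₁) = ((1 - x) * (Λ - 2 * d₁₀ - d₀) +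
        x * (Λ - β * (3 * (1 - ε) / 2) - 2 * (d₁₀ * (1 - (3 * (1 - ε) / 2) / fiveS ε)) - d₀)) / 3 := by
      unfold fiveIS; rw [hρx]; ring
    rw [e1]
    have t1 := mul_nonneg (sub_nonneg.2 hx1) (by linarith : (0:ℝ) ≤ Λ - 2 * d₁₀ - d₀)
    have t2 := mul_nonneg hx0 (by linarith : (0:ℝ) ≤ Λ - β * (3 * (1 - ε) / 2) -
          2 * (d₁₀ * (1 - (3 * (1 - ε) / 2) / fiveS ε)) - d₀)
    rcases lt_or_ge x 1 with hlt | hge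
    · have := mul_pos (sub_pos.2 hlt) (by linarith : (0:ℝ) < Λ - 2 * d₁₀ - d₀); linarith
    · have hx1' : x = 1 := le_antisymm hx1 hge
      rw [hx1']; linarith
  have hIMpos : 0 < fiveIM ε Λ β d₁₀ d₀ (s₀ + s₁) := by
    unfold fiveIM
    have : 0 ≤ d₁₀ * (1 - (s₀ + s₁) / fiveS ε) :=
      mul_nonneg hd1 (sub_nonneg.2 ((div_le_one hSpos).2 (by linarith)))
    linarith
  have hILpos : 0 < fiveIL ε Λ β d₁₀ d₀ (s₀ + s₁) := by unfold fiveIL; linarith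
  -- split the fibre `(0, L]` into the six consecutive pieces
  have hsplit : Ioc (0:ℝ) L = Ioc 0 b₁ ∪ Ioc b₁ b₂ ∪ Ioc b₂ z ∪ Ioc z b₄ ∪ Ioc b₄ e ∪ Ioc e L := by
    rw [Ioc_union_Ioc_eq_Ioc h01 h12, Ioc_union_Ioc_eq_Ioc (h01.trans h12) h2z,
      Ioc_union_Ioc_eq_Ioc ((h01.trans h12).trans h2z) hz4,
      Ioc_union_Ioc_eq_Ioc (((h01.trans h12).trans h2z).trans hz4) h4e,
      Ioc_union_Ioc_eq_Ioc ((((h01.trans h12).trans h2z).trans hz4).trans h4e) heL]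
  -- each piece in closed form
  have P1 : ∫⁻ u in Ioc (0:ℝ) b₁, ENNReal.ofReal (W u)⁻¹ =
      ENNReal.ofReal (Real.log ((fiveIS ε Λ β d₁₀ d₀ (s₀ + s₁) + fiveSS ε β d₁₀ * b₁) /
        (fiveIS ε Λ β d₁₀ d₀ (s₀ + s₁) + fiveSS ε β d₁₀ * 0)) / fiveSS ε β d₁₀) := by
    rw [← lintegral_Ioc_inv_affine h01 hSSpos (by simpa using hISpos)]
    refine setLIntegral_congr_fun measurableSet_Ioc fun u hu => ?_
    have huz : u ≤ z := hu.2.trans (min_le_right _ _)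
    have hus1 : u ≤ s₁ := hu.2.trans (min_le_left _ _)
    rw [hA3 u hu.1 huz, if_neg (not_lt.2 hus1), if_neg (not_lt.2 (hus1.trans hs01))]
    congr 2; ring
  have P2 : ∫⁻ u in Ioc b₁ b₂, ENNReal.ofReal (W u)⁻¹ =
      ENNReal.ofReal (Real.log ((fiveIM ε Λ β d₁₀ d₀ (s₀ + s₁) + fiveSM ε β d₁₀ * b₂) /
        (fiveIM ε Λ β d₁₀ d₀ (s₀ + s₁) + fiveSM ε β d₁₀ * b₁)) / fiveSM ε β d₁₀) := by
    rw [← lintegral_Ioc_inv_affine h12 hSMpos (add_pos_of_pos_of_nonneg hIMpos (mul_nonneg hSMpos.le h01))]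
    refine setLIntegral_congr_fun measurableSet_Ioc fun u hu => ?_
    have huz : u ≤ z := hu.2.trans (min_le_right _ _)
    have hus0 : u ≤ s₀ := hu.2.trans (min_le_left _ _)
    have hus1 : s₁ < u := by
      rcases min_lt_iff.1 hu.1 with h | h
      · exact h
      · exact absurd huz (not_le.2 h)
    rw [hA3 u (hs1.trans hus1) huz, if_pos hus1, if_neg (not_lt.2 hus0)]
    congr 2; unfold fiveIM fiveSM fiveSS; ring
  have P3 : ∫⁻ u in Ioc b₂ z, ENNReal.ofReal (W u)⁻¹ =
      ENNReal.ofReal (Real.log ((fiveIL ε Λ β d₁₀ d₀ (s₀ + s₁) + fiveSM ε β d₁₀ * z) /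
        (fiveIL ε Λ β d₁₀ d₀ (s₀ + s₁) + fiveSM ε β d₁₀ * b₂)) / fiveSM ε β d₁₀) := by
    rw [← lintegral_Ioc_inv_affine h2z hSMpos (add_pos_of_pos_of_nonneg hILpos (mul_nonneg hSMpos.le (h01.trans h12)))]
    refine setLIntegral_congr_fun measurableSet_Ioc fun u hu => ?_
    have huz : u ≤ z := hu.2
    have hus0 : s₀ < u := by
      rcases min_lt_iff.1 hu.1 with h | h
      · exact h
      · exact absurd huz (not_le.2 h)
    rw [hA3 u (hs0.trans hus0) huz, if_pos (lt_of_le_of_lt hs01 hus0), if_pos hus0]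
    congr 2; unfold fiveIL fiveIM fiveSM fiveSS; ring
  have P4 : ∫⁻ u in Ioc z b₄, ENNReal.ofReal (W u)⁻¹ = ENNReal.ofReal ((b₄ - z) / (Λ - c)) := by
    rw [← lintegral_Ioc_inv_const hz4]
    refine setLIntegral_congr_fun measurableSet_Ioc fun u hu => ?_
    have hus0 : u ≤ s₀ := by
      rcases le_max_iff.1 hu.2 with h | h
      · exact absurd hu.1 (not_lt.2 h)
      · exact h.trans (min_le_left _ _)
    rw [hA2 u hu.1 (hu.2.trans h4e), if_neg (not_lt.2 hus0)]
  have P5 : ∫⁻ u in Ioc b₄ e, ENNReal.ofReal (W u)⁻¹ = ENNReal.ofReal ((e - b₄) / c) := by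
    rw [← lintegral_Ioc_inv_const h4e]
    refine setLIntegral_congr_fun measurableSet_Ioc fun u hu => ?_
    have hzu : z < u := lt_of_le_of_lt hz4 hu.1
    have hus0 : s₀ < u := by
      have h' : min s₀ e < u := lt_of_le_of_lt (le_max_right _ _) hu.1
      rcases min_lt_iff.1 h' with h | h
      · exact h
      · exact absurd hu.2 (not_le.2 h)
    rw [hA2 u hzu hu.2, if_pos hus0]
  have P6 : ∫⁻ u in Ioc e L, ENNReal.ofReal (W u)⁻¹ = ENNReal.ofReal ((L - e) / Λ) := by
    rw [← lintegral_Ioc_inv_const heL]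
    refine setLIntegral_congr_fun measurableSet_Ioc fun u hu => ?_
    rw [hA1 u hu.1 hu.2]
  -- assemble: the integral over the union is at most the sum of the six pieces
  have key : ∫⁻ u in Ioc (0:ℝ) L, ENNReal.ofReal (W u)⁻¹ ≤
      ENNReal.ofReal (Real.log ((fiveIS ε Λ β d₁₀ d₀ (s₀ + s₁) + fiveSS ε β d₁₀ * b₁) /
        (fiveIS ε Λ β d₁₀ d₀ (s₀ + s₁) + fiveSS ε β d₁₀ * 0)) / fiveSS ε β d₁₀) +
      ENNReal.ofReal (Real.log ((fiveIM ε Λ β d₁₀ d₀ (s₀ + s₁) + fiveSM ε β d₁₀ * b₂) /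
        (fiveIM ε Λ β d₁₀ d₀ (s₀ + s₁) + fiveSM ε β d₁₀ * b₁)) / fiveSM ε β d₁₀) +
      ENNReal.ofReal (Real.log ((fiveIL ε Λ β d₁₀ d₀ (s₀ + s₁) + fiveSM ε β d₁₀ * z) /
        (fiveIL ε Λ β d₁₀ d₀ (s₀ + s₁) + fiveSM ε β d₁₀ * b₂)) / fiveSM ε β d₁₀) +
      ENNReal.ofReal ((b₄ - z) / (Λ - c)) + ENNReal.ofReal ((e - b₄) / c) +
      ENNReal.ofReal ((L - e) / Λ) := by
    rw [hsplit, ← P1, ← P2, ← P3, ← P4, ← P5, ← P6]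
    refine (lintegral_union_le _ _ _).trans (add_le_add ?_ le_rfl)
    refine (lintegral_union_le _ _ _).trans (add_le_add ?_ le_rfl)
    refine (lintegral_union_le _ _ _).trans (add_le_add ?_ le_rfl)
    refine (lintegral_union_le _ _ _).trans (add_le_add ?_ le_rfl)
    exact lintegral_union_le _ _ _
  -- nonnegativity of the six real terms, to merge the `ofReal`s
  have hlog1 : 0 ≤ Real.log ((fiveIS ε Λ β d₁₀ d₀ (s₀ + s₁) + fiveSS ε β d₁₀ * b₁) /
      (fiveIS ε Λ β d₁₀ d₀ (s₀ + s₁) + fiveSS ε β d₁₀ * 0)) / fiveSS ε β d₁₀ :=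
    div_nonneg (Real.log_nonneg ((one_le_div (by simpa using hISpos)).2
      (by have := mul_nonneg hSSpos.le h01; simp only [mul_zero, add_zero]; linarith))) hSSpos.le
  have hlog2 : 0 ≤ Real.log ((fiveIM ε Λ β d₁₀ d₀ (s₀ + s₁) + fiveSM ε β d₁₀ * b₂) /
      (fiveIM ε Λ β d₁₀ d₀ (s₀ + s₁) + fiveSM ε β d₁₀ * b₁)) / fiveSM ε β d₁₀ :=
    div_nonneg (Real.log_nonneg ((one_le_div (add_pos_of_pos_of_nonneg hIMpos (mul_nonneg hSMpos.le h01))).2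
      (by have := mul_le_mul_of_nonneg_left h12 hSMpos.le; linarith))) hSMpos.le
  have hlog3 : 0 ≤ Real.log ((fiveIL ε Λ β d₁₀ d₀ (s₀ + s₁) + fiveSM ε β d₁₀ * z) /
      (fiveIL ε Λ β d₁₀ d₀ (s₀ + s₁) + fiveSM ε β d₁₀ * b₂)) / fiveSM ε β d₁₀ :=
    div_nonneg (Real.log_nonneg ((one_le_div (add_pos_of_pos_of_nonneg hILpos
      (mul_nonneg hSMpos.le (h01.trans h12)))).2
      (by have := mul_le_mul_of_nonneg_left h2z hSMpos.le; linarith))) hSMpos.le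
  have hl4 : 0 ≤ (b₄ - z) / (Λ - c) := div_nonneg (sub_nonneg.2 hz4) (by linarith)
  have hl5 : 0 ≤ (e - b₄) / c := div_nonneg (sub_nonneg.2 h4e) (by linarith)
  have hl6 : 0 ≤ (L - e) / Λ := div_nonneg (sub_nonneg.2 heL) hΛ.le
  have hB : fiveBudget ε Λ β d₁₀ d₀ c s₀ s₁ =
      Real.log ((fiveIS ε Λ β d₁₀ d₀ (s₀ + s₁) + fiveSS ε β d₁₀ * b₁) /
        (fiveIS ε Λ β d₁₀ d₀ (s₀ + s₁) + fiveSS ε β d₁₀ * 0)) / fiveSS ε β d₁₀ +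
      Real.log ((fiveIM ε Λ β d₁₀ d₀ (s₀ + s₁) + fiveSM ε β d₁₀ * b₂) /
        (fiveIM ε Λ β d₁₀ d₀ (s₀ + s₁) + fiveSM ε β d₁₀ * b₁)) / fiveSM ε β d₁₀ +
      Real.log ((fiveIL ε Λ β d₁₀ d₀ (s₀ + s₁) + fiveSM ε β d₁₀ * z) /
        (fiveIL ε Λ β d₁₀ d₀ (s₀ + s₁) + fiveSM ε β d₁₀ * b₂)) / fiveSM ε β d₁₀ +
      (b₄ - z) / (Λ - c) + (e - b₄) / c + (L - e) / Λ := by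
    rfl
  have s12 := add_nonneg hlog1 hlog2
  have s123 := add_nonneg s12 hlog3
  have s1234 := add_nonneg s123 hl4
  have s12345 := add_nonneg s1234 hl5
  rw [hB, ENNReal.ofReal_add s12345 hl6, ENNReal.ofReal_add s1234 hl5, ENNReal.ofReal_add s123 hl4,
    ENNReal.ofReal_add s12 hlog3, ENNReal.ofReal_add hlog1 hlog2]
  exact key

end RankActivity

end Summit.Parity.GeneralizedHardyLittlewood.Theses.PolymathEpsThreeCeiling

end
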